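import Summits.BirchSwinnertonDyer.Rank1Residual.ManinAdditive.TwistingIsogenyAtThree
import Summits.BirchSwinnertonDyer.BirchSwinnertonDyer.Theorems.ManinLocalTwoThreeCongruenceNumberTwistInvariance
import HarnessLib

/-!
# E-desc-62 `CongruenceNumberTwistInvarianceAtThree` DISCHARGED: `congruenceNumberTwistInvarianceAtThree_holds`
# (cell `bsd-f2-manin`; the `…Holds` sibling of the conjecture leaf `TwistingIsogenyAtThree`, typer g13)

The row E-desc-62 of desc g9 (MEMO-desc §26.5), filed as the `@[conjecture]` obligation
`TwistingIsogenyAtThree.CongruenceNumberTwistInvarianceAtThree` (p647034, binders VERBATIM from HOME/desc/g9/Sketch-desc-g9.lean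
681206185c8e6613 :134), is a THEOREM in the tree with the SAME binders:
`Summit.BirchSwinnertonDyer.BirchSwinnertonDyer.Theorems.ManinLocalTwoThree.congruenceNumberTwistInvarianceAtThree`
(`Theorems/ManinLocalTwoThreeCongruenceNumberTwistInvariance.lean`, width seat `bsd-line-manin23-p2` gen 9, p645903 — via the
Petersson self-adjoint integral involution `B₃` of `S₂(Γ₀(N); ℤ)`, `aₙ ↦ (n/3) aₙ`).  This file records the discharge in the
conjecture-leaf convention (the leaf stays importable by the route files; the `_holds` theorem lives in the sibling) and feeds it
to desc's PROVED edge, giving the hypothesis-free form of «`3 · m_W ∣ r_W` on the twist-minimal member of a commuting pair».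
The other three rows of the leaf (E-desc-58, E-desc-59, E-desc-62′) remain open obligations (theorem-candidates with paper
proofs VALID per refuter-1 §R69).  PROVED lemmas only; axioms standard.  bears_on: stmt-BirchSwinnertonDyer-22968.  BSD is not
proved by this; Manin's conjecture is not proved by this; C3 is not closed by this.
-/

noncomputable section

open WeierstrassCurve Literature.NumberTheory.DiophantineGeometry Literature.NumberTheory.EllipticCurves
  Literature.NumberTheory.EllipticCurves.ModularForms

namespace Summit.BirchSwinnertonDyer.Rank1Residual.ManinAdditive.TwistingIsogenyAtThree

/-- **E-desc-62 holds**: the obligation `CongruenceNumberTwistInvarianceAtThree` is the tree theorem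
`Theorems.ManinLocalTwoThree.congruenceNumberTwistInvarianceAtThree` (p645903), binders identical. -/
theorem congruenceNumberTwistInvarianceAtThree_holds : CongruenceNumberTwistInvarianceAtThree :=
  Summit.BirchSwinnertonDyer.BirchSwinnertonDyer.Theorems.ManinLocalTwoThree.congruenceNumberTwistInvarianceAtThree

/-- Desc's edge `three_mul_modularDegree_dvd_congruenceNumber_of_jump` with its E-desc-62 hypothesis DISCHARGED: on a
commuting pair (`deg φ_{W′} = 3 · deg φ_W`, same conductor `9 ∣ N`, `W ⊗ (−3) ∼ W′`), ARS's `m ∣ r` for the large member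
forces `3 · m_W ∣ r_W` for the small member. -/
theorem three_mul_modularDegree_dvd_congruenceNumber_of_jump'
    {W W' : WeierstrassCurve ℚ} [W.IsElliptic] [W'.IsElliptic] [NeZero (W.conductorNorm ℤ)]
    [NeZero (W'.conductorNorm ℤ)] (D : ModularParametrizationData W (W.conductorNorm ℤ))
    (D' : ModularParametrizationData W' (W'.conductorNorm ℤ)) (h9 : 9 ∣ W.conductorNorm ℤ)
    (hN : W'.conductorNorm ℤ = W.conductorNorm ℤ) (hiso : IsIsogenous (W.quadraticTwist ((-3 : ℤ) : ℚ)) W')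
    (hjump : D'.modularDegree = 3 * D.modularDegree) (hARS : D'.modularDegree ∣ congruenceNumber D'.f) :
    3 * D.modularDegree ∣ congruenceNumber D.f :=
  three_mul_modularDegree_dvd_congruenceNumber_of_jump congruenceNumberTwistInvarianceAtThree_holds D D' h9 hN hiso
    hjump hARS

end Summit.BirchSwinnertonDyer.Rank1Residual.ManinAdditive.TwistingIsogenyAtThree

end
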